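import Mathlib.Analysis.Fourier.ZMod
import Mathlib.Data.Nat.Prime.Basic
import HarnessLib

/-!
# The uncertainty principle on `ℤ/N` and Tao's sharp form for prime `N` (Tao 2005)

Analysis/Fourier named-fact file. T. Tao, *An uncertainty principle for cyclic groups of prime
order*, Math. Res. Lett. 12 (2005) 121–127 = arXiv:math/0308286 (held: paper:arxiv-math_0308286,
§1 read). The basic inequality is D. L. Donoho, P. B. Stark, *Uncertainty principles and signal
recovery*, SIAM J. Appl. Math. 49 (1989) 906–931 and K. T. Smith, SIAM J. Appl. Math. 50 (1990)
(Tao's [donoho], [smith]); the prime case was found independently by A. Biró and R. Meshulam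
(Tao's footnote).

Setting (§1, verbatim where quoted). `G` a finite abelian group with a non-degenerate bi-character
`e`; "if `G` is the cyclic group `ℤ/Nℤ`, we may take `e(x,ξ) := e^{2πixξ/N}`"; the Fourier transform
`f̂(ξ) := |G|^{−1} ∑_x f(x) \overline{e(x,ξ)}`; `supp(f) := {x ∈ G : f(x) ≠ 0}`. "Thus, if `f` is
non-zero, we thus obtain the well-known uncertainty principle [donoho], [smith]
`|supp(f)| |supp(f̂)| ≥ |G|` (1)." ("sharp when `f` is a Dirac mass … More generally, if `H` is any
subgroup of `G`, and we set `f` to be the characteristic function `χ_H` … `|supp(f)| = |H|` and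
`|supp(f̂)| = |G|/|H|`"; equality only for such functions up to translation, modulation and
homogeneity, [prez] — NOT vendored.)

**Theorem 1** (verbatim): "Let `p` be a prime number. If `f : ℤ/pℤ → ℂ` is a non-zero function,
then `|supp(f)| + |supp(f̂)| ≥ p + 1`. Conversely, if `A` and `B` are two non-empty subsets of
`ℤ/pℤ` such that `|A| + |B| ≥ p + 1`, then there exists a function `f` such that `supp(f) = A` and
`supp(f̂) = B`."

**Vendored** over Mathlib's discrete Fourier transform `ZMod.dft` (`𝓕 f k = ∑_j stdAddChar(−jk) f j`,
i.e. `e(x,ξ) = e^{2πixξ/N}` WITHOUT the `1/|G|` — supports are normalisation-independent, so both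
statements transfer verbatim): `uncertaintyPrinciple_zmod` (inequality (1) for `G = ℤ/N`) and
`tao2005_uncertainty_prime` (Theorem 1, both directions). Supports are the `Finset`s
`{x | f x ≠ 0}` (`Finset.univ.filter`).

Grounds (as the printed endpoint/equality-case context explicitly invoked in their texts)
`Summit.QuantumAdvantage.QuantumAdvantage.Theses.AreaUncertainty.PairStability`
(stmt-QuantumAdvantage-9605: "Area 1 with full acceptance is the Donoho–Stark/Meshulam equality
case") and `…WalshCantorSaturates` (stmt-9611), and the cyclic-register items of routes
BochnerSampling / AreaUncertainty (`PorousFUP`, `CyclicCantorDecays`: the area `|X||T|/N ≥ 1`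
threshold below which no nonzero `u` is supported on `X` with `𝓕u` supported on `T`). Mathlib has
`ZMod.dft` and its inversion but no uncertainty principle (checked: `lean search 'supp.*dft'`).

## References

* T. Tao, Math. Res. Lett. 12 (2005) 121–127 = arXiv:math/0308286: §1 eq. (1), **Theorem 1**
  (= Theorem 1.1 of the journal version). [Tao2005]
* D. L. Donoho, P. B. Stark, SIAM J. Appl. Math. 49 (1989) 906–931, Thm. 1. [DonohoStark1989]
* R. Meshulam, *An uncertainty inequality for finite abelian groups*, European J. Combin. 27
  (2006) 63–67. [Meshulam2006]
-/

noncomputable section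

open scoped ZMod
open Finset

namespace Literature.Analysis.Fourier

/-- The support of `f : ℤ/N → ℂ` as a finite set, `supp(f) = {x : f(x) ≠ 0}` (Tao 2005, §1). [cite: Tao2005, §1] -/
def zmodSupport {N : ℕ} [NeZero N] (f : ZMod N → ℂ) : Finset (ZMod N) :=
  Finset.univ.filter fun x => f x ≠ 0

/-- **The uncertainty principle on `ℤ/N`** (Donoho–Stark 1989 / Smith 1990; Tao 2005, eq. (1):
"if `f` is non-zero … `|supp(f)| |supp(f̂)| ≥ |G|`"), for `G = ℤ/N` and Mathlib's `ZMod.dft`: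
a non-zero `f : ℤ/N → ℂ` has `|supp f| · |supp 𝓕f| ≥ N`. [cite: Tao2005, §1 eq. (1) (arXiv:math/0308286)] -/
def uncertaintyPrinciple_zmod : Prop :=
  ∀ (N : ℕ) [NeZero N] (f : ZMod N → ℂ), f ≠ 0 →
    N ≤ (zmodSupport f).card * (zmodSupport (ZMod.dft f)).card

/-- **Tao 2005, Theorem 1 (uncertainty principle for cyclic groups of prime order).** For a prime
`p`: (i) every non-zero `f : ℤ/p → ℂ` has `|supp f| + |supp 𝓕f| ≥ p + 1`; (ii) conversely, for
non-empty `A, B ⊆ ℤ/p` with `|A| + |B| ≥ p + 1` there is `f` with `supp f = A` and `supp 𝓕f = B`. [cite: Tao2005, Theorem 1 (arXiv:math/0308286 §1)] -/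
def tao2005_uncertainty_prime : Prop :=
  ∀ (p : ℕ) [Fact p.Prime],
    (∀ f : ZMod p → ℂ, f ≠ 0 → p + 1 ≤ (zmodSupport f).card + (zmodSupport (ZMod.dft f)).card) ∧
    (∀ A B : Finset (ZMod p), A.Nonempty → B.Nonempty → p + 1 ≤ A.card + B.card →
      ∃ f : ZMod p → ℂ, zmodSupport f = A ∧ zmodSupport (ZMod.dft f) = B)

/-! ### Sanity lemmas -/

/-- The support of the zero function is empty; a function with empty support is zero. [folklore] -/
theorem zmodSupport_eq_empty_iff {N : ℕ} [NeZero N] (f : ZMod N → ℂ) :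
    zmodSupport f = ∅ ↔ f = 0 := by
  constructor
  · intro h
    funext x
    by_contra hx
    have hx' : f x ≠ 0 := fun h0 => hx (by simpa using h0)
    have : x ∈ zmodSupport f := by simp [zmodSupport, hx']
    rw [h] at this
    exact Finset.notMem_empty x this
  · rintro rfl
    simp [zmodSupport]

/-- Under the basic principle a non-zero function and its transform cannot both have support of
size `1` unless `N = 1`; in particular `supp f` non-empty forces `supp 𝓕f` non-empty (the transform
of a non-zero function is non-zero — also immediate from invertibility of `𝓕`). [folklore] -/
theorem uncertaintyPrinciple_zmod.card_pos (h : uncertaintyPrinciple_zmod) {N : ℕ} [NeZero N]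
    {f : ZMod N → ℂ} (hf : f ≠ 0) : 0 < (zmodSupport (ZMod.dft f)).card := by
  have hN : 0 < N := Nat.pos_of_ne_zero (NeZero.ne N)
  have := h N f hf
  rcases Nat.eq_zero_or_pos (zmodSupport (ZMod.dft f)).card with h0 | hpos
  · rw [h0, mul_zero] at this; omega
  · exact hpos

/-- Theorem 1 (i) refines eq. (1) for primes: from `a + b ≥ p + 1` with `1 ≤ a, b ≤ p` one gets
`a · b ≥ p` (AM–GM on the boundary). Recorded as the arithmetic bridge between the two facts. [folklore] -/
theorem mul_ge_of_add_ge_succ {p a b : ℕ} (ha : a ≤ p) (hb : b ≤ p) (hab : p + 1 ≤ a + b) :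
    p ≤ a * b := by
  rcases Nat.eq_zero_or_pos a with rfl | ha0
  · omega
  rcases Nat.eq_zero_or_pos b with rfl | hb0
  · omega
  -- a, b ≥ 1 and a + b ≥ p + 1: then (a - 1)(b - 1) ≥ 0 gives ab ≥ a + b - 1 ≥ p
  nlinarith

/-! ### Proof of eq. (1): `uncertaintyPrinciple_zmod_holds`

Tao's printed derivation of (1) (§1, p. 1 of arXiv:math/0308286) is the chain
`sup |f̂| ≤ |G|⁻¹ ∑ |f| ≤ (|supp f|/|G|)^{1/2} ‖f‖₂ = (|supp f|/|G|)^{1/2} ‖f̂‖₂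
 ≤ (|supp f| |supp f̂| / |G|)^{1/2} sup |f̂|` (triangle inequality, Cauchy–Schwarz, Plancherel,
Hölder on `supp f̂`), then divide by `sup |f̂| > 0`. Mathlib's `ZMod.dft` comes with the inversion
formula `ZMod.dft_dft : 𝓕 (𝓕 Φ) = fun j ↦ (N : ℂ) • Φ (-j)` but with no Plancherel identity, so we
run the same sandwich in its `L¹/L^∞` form (Donoho–Stark's original argument): the one-line bound
`‖𝓕 g ξ‖ ≤ |supp g| · sup ‖g‖` (triangle inequality, `|e(x, ξ)| = 1`) is applied to `g = f` and to
`g = 𝓕 f`, and the chain is closed by inversion, `N · sup ‖f‖ ≤ sup ‖𝓕 𝓕 f‖`. No normalisation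
enters: supports and the final inequality are scale-invariant. -/

/-- Values outside the support vanish. [folklore] -/
theorem apply_eq_zero_of_notMem_zmodSupport {N : ℕ} [NeZero N] {f : ZMod N → ℂ} {x : ZMod N}
    (hx : x ∉ zmodSupport f) : f x = 0 := by
  by_contra h
  exact hx (by simp [zmodSupport, h])

/-- `L¹`–`L^∞` bound for the discrete Fourier transform, restricted to the support: if `‖g x‖ ≤ C`
for all `x` then `‖𝓕 g ξ‖ ≤ |supp g| · C` for every `ξ` (triangle inequality and `|e(x,ξ)| = 1`;
first line of Tao's display in §1). [cite: Tao2005, §1 (arXiv:math/0308286)] -/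
theorem norm_dft_apply_le_card_mul {N : ℕ} [NeZero N] (g : ZMod N → ℂ) {C : ℝ}
    (hC : ∀ x, ‖g x‖ ≤ C) (ξ : ZMod N) :
    ‖ZMod.dft g ξ‖ ≤ (zmodSupport g).card * C := by
  rw [ZMod.dft_apply]
  calc ‖∑ j : ZMod N, ZMod.stdAddChar (-(j * ξ)) • g j‖
      ≤ ∑ j : ZMod N, ‖ZMod.stdAddChar (-(j * ξ)) • g j‖ := norm_sum_le _ _
    _ = ∑ j : ZMod N, ‖g j‖ := by
        refine Finset.sum_congr rfl fun j _ => ?_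
        rw [norm_smul, ZMod.stdAddChar_apply, Circle.norm_coe, one_mul]
    _ = ∑ j ∈ zmodSupport g, ‖g j‖ := by
        symm
        refine Finset.sum_subset (Finset.subset_univ _) fun j _ hj => ?_
        rw [apply_eq_zero_of_notMem_zmodSupport hj, norm_zero]
    _ ≤ ∑ j ∈ zmodSupport g, C := Finset.sum_le_sum fun j _ => hC j
    _ = (zmodSupport g).card * C := by rw [Finset.sum_const, nsmul_eq_mul]

/-- **Eq. (1) of Tao 2005 holds on `ℤ/N`** (the Donoho–Stark / Smith uncertainty principle):
a non-zero `f : ℤ/N → ℂ` has `N ≤ |supp f| · |supp 𝓕f|`. Proof: with `M := max ‖f‖ > 0` and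
`M' := max ‖𝓕 f‖`, `norm_dft_apply_le_card_mul` gives `M' ≤ |supp f| M` and, through the inversion
formula `𝓕 𝓕 f (-x) = N f x` (`ZMod.dft_dft`), `N M ≤ |supp 𝓕f| M'`; divide by `M`. [cite: Tao2005, §1 eq. (1) (arXiv:math/0308286); DonohoStark1989, Thm. 1] -/
theorem uncertaintyPrinciple_zmod_holds : uncertaintyPrinciple_zmod := by
  intro N _ f hf
  -- the sup norms of `f` and `𝓕 f` are attained at `x₀` and `ξ₀`
  obtain ⟨x₀, hx₀⟩ := Finite.exists_max fun x => ‖f x‖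
  obtain ⟨ξ₀, hξ₀⟩ := Finite.exists_max fun ξ => ‖ZMod.dft f ξ‖
  -- `f ≠ 0`, so `max ‖f‖ > 0`
  have hMpos : 0 < ‖f x₀‖ := by
    obtain ⟨x₁, hx₁⟩ := Function.ne_iff.mp hf
    exact lt_of_lt_of_le (norm_pos_iff.mpr hx₁) (hx₀ x₁)
  -- step 1: `max ‖𝓕 f‖ ≤ |supp f| · max ‖f‖`
  have h1 : ‖ZMod.dft f ξ₀‖ ≤ (zmodSupport f).card * ‖f x₀‖ :=
    norm_dft_apply_le_card_mul f hx₀ ξ₀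
  -- step 2 (inversion): `N · max ‖f‖ = ‖𝓕 (𝓕 f) (-x₀)‖ ≤ |supp 𝓕f| · max ‖𝓕 f‖`
  have h2 : (N : ℝ) * ‖f x₀‖ ≤ (zmodSupport (ZMod.dft f)).card * ‖ZMod.dft f ξ₀‖ := by
    have key : ZMod.dft (ZMod.dft f) (-x₀) = (N : ℂ) * f x₀ := by
      rw [ZMod.dft_dft]
      simp
    have h := norm_dft_apply_le_card_mul (ZMod.dft f) hξ₀ (-x₀)
    rwa [key, norm_mul, Complex.norm_natCast] at h
  -- combine and cancel `max ‖f‖ > 0`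
  have h3 : (N : ℝ) * ‖f x₀‖ ≤
      ((zmodSupport f).card * (zmodSupport (ZMod.dft f)).card : ℕ) * ‖f x₀‖ :=
    calc (N : ℝ) * ‖f x₀‖ ≤ (zmodSupport (ZMod.dft f)).card * ‖ZMod.dft f ξ₀‖ := h2
      _ ≤ (zmodSupport (ZMod.dft f)).card * ((zmodSupport f).card * ‖f x₀‖) := by gcongr
      _ = ((zmodSupport f).card * (zmodSupport (ZMod.dft f)).card : ℕ) * ‖f x₀‖ := by
          push_cast; ring
  exact_mod_cast le_of_mul_le_mul_right h3 hMpos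

end Literature.Analysis.Fourier

end
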